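/-
Copyright: statement-level skeleton of a published paper (lit-balaban cell, Phase-2 proof seat p30, gen 2). No proof
claims beyond what the kernel checks below.
-/
import Literature.MathematicalPhysics.QuantumFieldTheory.BalabanImbrieJaffe1984to88.BIJ85AppAStatements

/-!
# `BalabanImbrieJaffe1984to88.BIJ85PropA1Proof` — T. Bałaban, J. Imbrie, A. Jaffe, *Renormalization of the Higgs model:
minimizers, propagators and the stability of mean field theory*, Commun. Math. Phys. **97** (1985) 299–329
[BalabanImbrieJaffe1985]: Appendix "Quadratic Forms" p. 327 — the clauses of **Proposition A1** left untyped by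
`BIJ85AppAStatements` (*"Range α* = Domain Δ⁻¹, so P = αΔ⁻¹α*"*, *"P² = P = P*, and Pα = α. Thus P is the projection onto
Range α"*, the minimizer A_cl = −Δ⁻¹α*B AS PRINTED and its uniqueness), typed over Mathlib's finite-dimensional adjoint and PROVED

statement-level skeleton of published theorems with citation tags; proofs where landed; nothing here is a claim about the Yang–Mills mass gap

PDF held: `paper:balaban1985-cmp97-bij-higgs-minimizers` (journal page = PDF page + 298).  Renders read as images: pp. 327–329
(`HOME/lit-balaban-r15/pages/1985-cmp97-bij-higgs-minimizers-p029-x2.png`, `…-p030-x2.png`, `…-p031-x2.png`).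

CITATION HEADER (lean-in-tree rule).  Part of the lit-balaban TYPED SKELETON (HOME `run/shared/lean/pub/lit-balaban/`): WHAT IS
REPRODUCED = row **C1.PropA1** of `HOME/lit-balaban-r15/ROWS-C1-part2.md` (`typed p239653`; r15's `BIJ85AppAStatements.propA1_min`
docstring: *"NOT typed here: the range statement, the formula for P, uniqueness"*) — those three clauses are typed and PROVED here,
and r15's `propA1_min` / `hForm_min_eq` / `corA2` (which take A_cl through the normal equation `hnormal` and P through an abstract
self-adjoint idempotent) are FED with the printed objects A_cl = −Δ⁻¹α*B and P = αΔ⁻¹α*.  First of three Appendix-A files of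
seat p30 gen 2 (`BIJ85PropA1Proof`, `BIJ85AppALemmas`, `BIJ85PropA3Proof`); earlier p30 siblings `BIJ85Eq611Proof`, `BIJ85Eq625Proof`,
`BIJ85Eq427Proof`, `BIJ85Eq317Proof`; unit `lit-balaban-p30`.

THE PRINTED TEXT (verbatim, p. 326–327 [PDF 28–29]).  *"As a first example, let 0 ≤ Δ = α*α be a self-adjoint transformation on ℋ
and let B ∈ ℋ. Define the quadratic form h(A) = ½‖αA + B‖². (A1) Let P denote the projection onto Range(α).  Proposition A1.
Range α* = Domain Δ⁻¹, so P = αΔ⁻¹α*. Furthermore h(A) ≥ h(A_cl) = ½⟨B,(I−P)B⟩, (A2) where A_cl = −Δ⁻¹α*B (A3) is the unique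
minimum of (A1).  Proof. Note that Range α* = (Kernel α)^⊥ and Kernel α = Kernel Δ. By the spectral theorem ℋ = Kernel(Δ) ⊕
Range(Δ), so Range α* = Range Δ = Domain Δ⁻¹. Therefore P = αΔ⁻¹α* exists, P² = P = P*, and Pα = α. Thus P is the projection
onto Range α. Writing h(A) = ½‖Δ^{1/2}A + Δ^{−1/2}α*B‖² + ½⟨B,(I−P)B⟩ yields (A2). Since h(A) is convex, the minimum is unique,
to complete the proof."*

THE TYPING.  ℋ ∋ A and ℋ ∋ B as two finite-dimensional real inner product spaces `E`, `F` (p. 326: *"Since we work with lattice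
fields, our space ℋ is finite dimensional"*; E = F = ℋ in print, the extra generality is free), α : E →ₗ F linear, α* = Mathlib's
`LinearMap.adjoint α` (`hadj_adjoint` = r15's hypothesis `hadj`), Δ = α*α = `α.adjoint ∘ₗ α`; Domain Δ⁻¹ := Range Δ with Δ⁻¹ =
`deltaInv α` the inverse of Δ↾Range Δ (`deltaOn`, injective by *"ℋ = Kernel(Δ) ⊕ Range(Δ)"*); P = αΔ⁻¹α* = `projP α`; A_cl =
`Acl α B`.  WHAT IS PROVED (Mathlib's Axler-7.64 lemmas `ker_adjoint_comp_self` / `range_adjoint_comp_self` /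
`orthogonal_ker` supply *"Kernel α = Kernel Δ"*, *"Range α* = Range Δ"*, *"Range α* = (Kernel α)^⊥"*): `range_adjoint_eq_range_delta`
(Range α* = Domain Δ⁻¹), `delta_Acl` / `normal_Acl` (ΔA_cl = −α*B), `projP_eq_starProjection` (*"P is the projection onto Range α"*
= Mathlib's orthogonal projection `Submodule.starProjection`), `projP_apply_range` (Pα = α), `projP_idem` (P² = P), `projP_symm`
(P = P*), `hForm_Acl` ((A2) value h(A_cl) = ½⟨B,(I−P)B⟩ with the printed P), `hForm_Acl_le` ((A2) inequality), `hForm_eq_min_iff`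
(the minimizer set is A_cl + Kernel α) and `Acl_unique` (A_cl is THE minimizer in Domain Δ⁻¹ = Range Δ).  TRANSCRIPT NOTE T7:
*"Since h(A) is convex, the minimum is unique"* — h is constant on A_cl + Kernel α (`hForm_eq_min_iff`), so when Kernel α = Kernel Δ
≠ 0 (the case the sentence *"ℋ = Kernel(Δ) ⊕ Range(Δ)"* allows) the minimizer is unique exactly within Domain Δ⁻¹ = Range Δ ∋
A_cl; that is the reading typed (`Acl_unique`); for Kernel α = 0 it is global uniqueness.  Carrier clauses (F6): none — Mathlib's
inner-product-space structures only; NOTHING of the paper is asserted beyond the kernel-checked statements below.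
-/

open scoped RealInnerProductSpace

namespace Literature.MathematicalPhysics.QuantumFieldTheory.BalabanImbrieJaffe1984to88.BIJ85PropA1Proof

open BIJ85AppAStatements

/-! ## Proposition A1 p. 327: the clauses left untyped in `BIJ85AppAStatements` -/

section PropA1

variable {E F : Type*} [NormedAddCommGroup E] [InnerProductSpace ℝ E] [FiniteDimensional ℝ E]
  [NormedAddCommGroup F] [InnerProductSpace ℝ F] [FiniteDimensional ℝ F]

/-- α* := Mathlib's `LinearMap.adjoint α` is an adjoint pair (α, α*) in the sense of the hypothesis `hadj` of
`BIJ85AppAStatements.corA2` / `propA1_min` ("0 ≤ Δ = α*α", p. 326). [cite: BalabanImbrieJaffe1985, (A1) p.326] -/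
theorem hadj_adjoint (α : E →ₗ[ℝ] F) (x : E) (y : F) : ⟪α x, y⟫ = ⟪x, α.adjoint y⟫ :=
  (LinearMap.adjoint_inner_right α x y).symm

/-- Proof of Prop. A1, p. 327: *"Kernel α = Kernel Δ"* (Δ = α*α). [cite: BalabanImbrieJaffe1985, Prop. A1 p.327] -/
theorem ker_delta_eq (α : E →ₗ[ℝ] F) : LinearMap.ker (α.adjoint ∘ₗ α) = LinearMap.ker α :=
  α.ker_adjoint_comp_self

/-- Proof of Prop. A1, p. 327: *"Range α* = (Kernel α)^⊥"*. [cite: BalabanImbrieJaffe1985, Prop. A1 p.327] -/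
theorem range_adjoint_eq_orthogonal_ker (α : E →ₗ[ℝ] F) :
    LinearMap.range α.adjoint = (LinearMap.ker α)ᗮ :=
  (α.orthogonal_ker).symm

/-- **Prop. A1**, first clause, p. 327: *"Range α* = Domain Δ⁻¹"*, i.e. (proof) *"Range α* = Range Δ = Domain Δ⁻¹"* — Δ⁻¹
being defined on Range Δ (`deltaInv`). [cite: BalabanImbrieJaffe1985, Prop. A1 p.327] -/
theorem range_adjoint_eq_range_delta (α : E →ₗ[ℝ] F) :
    LinearMap.range α.adjoint = LinearMap.range (α.adjoint ∘ₗ α) :=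
  (α.range_adjoint_comp_self).symm

/-- Δ = α*α restricted to Range Δ = Domain Δ⁻¹ (an endomorphism of that subspace). [cite: BalabanImbrieJaffe1985, Prop. A1 p.327] -/
noncomputable def deltaOn (α : E →ₗ[ℝ] F) :
    LinearMap.range (α.adjoint ∘ₗ α) →ₗ[ℝ] LinearMap.range (α.adjoint ∘ₗ α) :=
  (α.adjoint ∘ₗ α).restrict fun x _ => LinearMap.mem_range_self _ x

/-- Δ↾Range Δ acts as Δ. [cite: BalabanImbrieJaffe1985, Prop. A1 p.327] -/
theorem deltaOn_coe (α : E →ₗ[ℝ] F) (x : LinearMap.range (α.adjoint ∘ₗ α)) :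
    ((deltaOn α x : LinearMap.range (α.adjoint ∘ₗ α)) : E) = (α.adjoint ∘ₗ α) x := rfl

/-- *"By the spectral theorem ℋ = Kernel(Δ) ⊕ Range(Δ)"* (p. 327): Δ is injective on Range Δ = (Kernel Δ)^⊥.
[cite: BalabanImbrieJaffe1985, Prop. A1 p.327] -/
theorem deltaOn_injective (α : E →ₗ[ℝ] F) : Function.Injective (deltaOn α) := by
  intro x y hxy
  have hval : (α.adjoint ∘ₗ α) (x : E) = (α.adjoint ∘ₗ α) (y : E) := by
    have h := congrArg Subtype.val hxy
    rwa [deltaOn_coe, deltaOn_coe] at h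
  have hk : (x : E) - y ∈ LinearMap.ker α := by
    rw [← ker_delta_eq, LinearMap.mem_ker, map_sub, hval, sub_self]
  have hr : (x : E) - y ∈ (LinearMap.ker α)ᗮ := by
    rw [← range_adjoint_eq_orthogonal_ker, range_adjoint_eq_range_delta]
    exact Submodule.sub_mem _ x.2 y.2
  have h0 : ⟪(x : E) - y, (x : E) - y⟫ = 0 := (Submodule.mem_orthogonal _ _).mp hr _ hk
  exact Subtype.ext (sub_eq_zero.mp (inner_self_eq_zero.mp h0))

/-- Δ⁻¹ : Range Δ → Range Δ, *"Domain Δ⁻¹ = Range Δ"* (p. 327), as the inverse of `deltaOn`.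
[cite: BalabanImbrieJaffe1985, Prop. A1 (A3) p.327] -/
noncomputable def deltaInv (α : E →ₗ[ℝ] F) :
    LinearMap.range (α.adjoint ∘ₗ α) →ₗ[ℝ] LinearMap.range (α.adjoint ∘ₗ α) :=
  ((LinearEquiv.ofInjectiveEndo (deltaOn α) (deltaOn_injective α)).symm :
    LinearMap.range (α.adjoint ∘ₗ α) →ₗ[ℝ] LinearMap.range (α.adjoint ∘ₗ α))

/-- ΔΔ⁻¹ = I on Range Δ. [cite: BalabanImbrieJaffe1985, Prop. A1 (A3) p.327] -/
theorem delta_deltaInv (α : E →ₗ[ℝ] F) (y : LinearMap.range (α.adjoint ∘ₗ α)) :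
    (α.adjoint ∘ₗ α) ((deltaInv α y : LinearMap.range (α.adjoint ∘ₗ α)) : E) = y := by
  have h := congrArg Subtype.val
    ((LinearEquiv.ofInjectiveEndo (deltaOn α) (deltaOn_injective α)).apply_symm_apply y)
  rw [LinearEquiv.coe_ofInjectiveEndo, deltaOn_coe] at h
  unfold deltaInv
  rw [LinearEquiv.coe_coe]
  exact h

/-- α*B ∈ Range Δ = Domain Δ⁻¹ (so that αΔ⁻¹α* and Δ⁻¹α*B make sense, p. 327 *"Therefore P = αΔ⁻¹α* exists"*).
[cite: BalabanImbrieJaffe1985, Prop. A1 p.327] -/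
theorem adjoint_mem_range_delta (α : E →ₗ[ℝ] F) (B : F) :
    α.adjoint B ∈ LinearMap.range (α.adjoint ∘ₗ α) := by
  rw [← range_adjoint_eq_range_delta]
  exact LinearMap.mem_range_self _ B

/-- **P = αΔ⁻¹α*** p. 327 [PDF 29], Prop. A1: *"Range α* = Domain Δ⁻¹, so P = αΔ⁻¹α*"*. [cite: BalabanImbrieJaffe1985, Prop. A1 p.327] -/
noncomputable def projP (α : E →ₗ[ℝ] F) : F →ₗ[ℝ] F :=
  α ∘ₗ (LinearMap.range (α.adjoint ∘ₗ α)).subtype ∘ₗ deltaInv α ∘ₗ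
    LinearMap.codRestrict (LinearMap.range (α.adjoint ∘ₗ α)) α.adjoint (adjoint_mem_range_delta α)

/-- **(A3)** p. 327 [PDF 29]: *"A_cl = −Δ⁻¹α*B"*, Δ⁻¹ = `deltaInv` on Range Δ ∋ α*B. [cite: BalabanImbrieJaffe1985, Prop. A1 (A3) p.327] -/
noncomputable def Acl (α : E →ₗ[ℝ] F) (B : F) : E :=
  -((deltaInv α (LinearMap.codRestrict (LinearMap.range (α.adjoint ∘ₗ α)) α.adjoint (adjoint_mem_range_delta α) B) :
      LinearMap.range (α.adjoint ∘ₗ α)) : E)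

/-- ΔA_cl = −α*B ((A3) multiplied by Δ). [cite: BalabanImbrieJaffe1985, Prop. A1 (A3) p.327] -/
theorem delta_Acl (α : E →ₗ[ℝ] F) (B : F) : α.adjoint (α (Acl α B)) = -α.adjoint B := by
  have h := delta_deltaInv α
    (LinearMap.codRestrict (LinearMap.range (α.adjoint ∘ₗ α)) α.adjoint (adjoint_mem_range_delta α) B)
  rw [LinearMap.codRestrict_apply] at h
  simp only [LinearMap.coe_comp, Function.comp_apply] at h
  unfold Acl
  rw [map_neg, map_neg, h]

/-- A_cl of (A3) satisfies the normal equation α*(αA_cl + B) = 0 (the hypothesis `hnormal` of `corA2`/`propA1_min`).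
[cite: BalabanImbrieJaffe1985, Prop. A1 (A3) p.327] -/
theorem normal_Acl (α : E →ₗ[ℝ] F) (B : F) : α.adjoint (α (Acl α B) + B) = 0 := by
  rw [map_add, delta_Acl, neg_add_cancel]

/-- A_cl ∈ Range Δ = Domain Δ⁻¹. [cite: BalabanImbrieJaffe1985, Prop. A1 (A3) p.327] -/
theorem Acl_mem_range (α : E →ₗ[ℝ] F) (B : F) : Acl α B ∈ LinearMap.range (α.adjoint ∘ₗ α) := by
  unfold Acl
  exact Submodule.neg_mem _ (Subtype.coe_prop _)

/-- PB = αΔ⁻¹α*B = −αA_cl. [cite: BalabanImbrieJaffe1985, Prop. A1 p.327] -/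
theorem projP_apply (α : E →ₗ[ℝ] F) (B : F) : projP α B = -α (Acl α B) := by
  simp only [projP, Acl, LinearMap.coe_comp, Function.comp_apply, Submodule.coe_subtype, map_neg, neg_neg]

/-- **Prop. A1**, p. 327 [PDF 29]: *"Thus P is the projection onto Range α"* — P = αΔ⁻¹α* coincides with the orthogonal
projection of ℋ onto Range α (Mathlib `Submodule.starProjection`). [cite: BalabanImbrieJaffe1985, Prop. A1 p.327] -/
theorem projP_eq_starProjection (α : E →ₗ[ℝ] F) (B : F) :
    projP α B = (LinearMap.range α).starProjection B := by
  symm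
  apply Submodule.eq_starProjection_of_mem_orthogonal
  · rw [projP_apply, ← map_neg]
    exact LinearMap.mem_range_self α _
  · rw [LinearMap.orthogonal_range, LinearMap.mem_ker, projP_apply, sub_neg_eq_add, add_comm]
    exact normal_Acl α B

/-- *"Pα = α"* (p. 327). [cite: BalabanImbrieJaffe1985, Prop. A1 p.327] -/
theorem projP_apply_range (α : E →ₗ[ℝ] F) (A : E) : projP α (α A) = α A := by
  rw [projP_eq_starProjection]
  exact Submodule.starProjection_eq_self_iff.mpr (LinearMap.mem_range_self α A)

/-- *"P² = P"* (p. 327). [cite: BalabanImbrieJaffe1985, Prop. A1 p.327] -/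
theorem projP_idem (α : E →ₗ[ℝ] F) (B : F) : projP α (projP α B) = projP α B := by
  rw [projP_apply α B, ← map_neg, projP_apply_range]

/-- *"P = P*"* (p. 327). [cite: BalabanImbrieJaffe1985, Prop. A1 p.327] -/
theorem projP_symm (α : E →ₗ[ℝ] F) (B B' : F) : ⟪projP α B, B'⟫ = ⟪B, projP α B'⟫ := by
  rw [projP_eq_starProjection, projP_eq_starProjection]
  exact Submodule.inner_starProjection_left_eq_right _ B B'

/-- **(A2)**, the value, p. 327 [PDF 29]: *"h(A_cl) = ½⟨B,(I−P)B⟩"* with P = αΔ⁻¹α* and A_cl = −Δ⁻¹α*B (both as printed),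
from r15's `hForm_min_eq`. [cite: BalabanImbrieJaffe1985, Prop. A1 (A2) p.327] -/
theorem hForm_Acl (α : E →ₗ[ℝ] F) (B : F) : hForm α B (Acl α B) = (1 / 2) * ⟪B, B - projP α B⟫ := by
  have h := hForm_min_eq α B (Acl α B) (LinearMap.id - projP α) ?_ ?_ ?_
  · simpa using h
  · intro x y
    simp only [LinearMap.sub_apply, LinearMap.id_coe, id_eq, inner_sub_left, inner_sub_right, projP_symm]
  · intro x
    simp only [LinearMap.sub_apply, LinearMap.id_coe, id_eq, map_sub, projP_idem, sub_self, sub_zero]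
  · simp only [LinearMap.sub_apply, LinearMap.id_coe, id_eq, projP_apply, sub_neg_eq_add]
    exact add_comm _ _

/-- **(A2)**, the inequality, p. 327 [PDF 29]: *"h(A) ≥ h(A_cl)"* for the printed A_cl = −Δ⁻¹α*B (r15's `propA1_min` fed
with `normal_Acl`). [cite: BalabanImbrieJaffe1985, Prop. A1 (A2) p.327] -/
theorem hForm_Acl_le (α : E →ₗ[ℝ] F) (B : F) (A : E) : hForm α B (Acl α B) ≤ hForm α B A :=
  propA1_min α α.adjoint (hadj_adjoint α) B (Acl α B) (normal_Acl α B) A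

/-- The minimizer set of (A1), p. 327 (*"Since h(A) is convex, the minimum is unique"*, TRANSCRIPT NOTE T7): h(A) = h(A_cl)
iff A − A_cl ∈ Kernel α = Kernel Δ. [cite: BalabanImbrieJaffe1985, Prop. A1 p.327] -/
theorem hForm_eq_min_iff (α : E →ₗ[ℝ] F) (B : F) (A : E) :
    hForm α B A = hForm α B (Acl α B) ↔ A - Acl α B ∈ LinearMap.ker α := by
  have h := corA2 α α.adjoint (hadj_adjoint α) B (Acl α B) (normal_Acl α B) (A - Acl α B)
  rw [sub_add_cancel] at h
  rw [h, LinearMap.mem_ker, ← hadj_adjoint, real_inner_self_eq_norm_sq]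
  constructor
  · intro h2
    have h3 : ‖α (A - Acl α B)‖ ^ 2 = 0 := by linarith
    exact norm_eq_zero.mp (pow_eq_zero_iff two_ne_zero |>.mp h3)
  · intro h0
    rw [h0, norm_zero]
    ring

/-- **Prop. A1**, uniqueness, p. 327 [PDF 29]: *"A_cl = −Δ⁻¹α*B (A3) is the unique minimum of (A1)"* — within Domain Δ⁻¹ =
Range Δ (∋ A_cl, `Acl_mem_range`) the minimizer is unique (TRANSCRIPT NOTE T7). [cite: BalabanImbrieJaffe1985, Prop. A1 (A3) p.327] -/
theorem Acl_unique (α : E →ₗ[ℝ] F) (B : F) (A : E) (hA : A ∈ LinearMap.range (α.adjoint ∘ₗ α))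
    (hmin : hForm α B A = hForm α B (Acl α B)) : A = Acl α B := by
  have hk : A - Acl α B ∈ LinearMap.ker α := (hForm_eq_min_iff α B A).mp hmin
  have hr : A - Acl α B ∈ (LinearMap.ker α)ᗮ := by
    rw [← range_adjoint_eq_orthogonal_ker, range_adjoint_eq_range_delta]
    exact Submodule.sub_mem _ hA (Acl_mem_range α B)
  have h0 : ⟪A - Acl α B, A - Acl α B⟫ = 0 := (Submodule.mem_orthogonal _ _).mp hr _ hk
  exact sub_eq_zero.mp (inner_self_eq_zero.mp h0)

end PropA1

end Literature.MathematicalPhysics.QuantumFieldTheory.BalabanImbrieJaffe1984to88.BIJ85PropA1Proof
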